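import Summits.AtomisticToContinuum.Crystallization.Theorems.SquareWellLayerCakeGapTwelveToBarlowCombinatorialLayeringTransportSteps1
import Summits.AtomisticToContinuum.Crystallization.Theorems.SquareWellLayerCakeGapTwelveToBarlowCombinatorialLayeringTransportSteps6
import Summits.AtomisticToContinuum.Crystallization.Theorems.SquareWellLayerCakeGapTwelveToBarlowCombinatorialLayeringTransportLower
import Summits.AtomisticToContinuum.Crystallization.Theorems.SquareWellLayerCakeGapTwelveToBarlowCombinatorialLayeringTransportVinv
import Summits.AtomisticToContinuum.Crystallization.Theorems.SquareWellLayerCakeGapTwelveToBarlowCombinatorialLayeringTransportAttach1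
import Summits.AtomisticToContinuum.Crystallization.Theorems.PalmUnimodularRigidityShellsToBarlowChartTransportGlobalD

/-!
# Combinatorial layering (B1a of `GapTwelveToBarlow`): transport port, part `GlobalD`

Crux `SquareWellLayerCake.GapTwelveToBarlow` (stmt-AtomisticToContinuum-15807), line `Sketch`,
stub `stub_combinatorialLayering`, residual `(H_develop)`.  PORT of the tree file
`PalmUnimodularRigidityShellsToBarlowChartTransportGlobalD.lean` (crux 9227) to GRADED COMBINATORIAL
charts, following the port rules recorded in `…CombinatorialLayeringTransportSteps1` (bundled
standing hypothesis `hch` on `S : ℕ → Set E3`, abstract bond relation `B`, memberships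
`x ∈ S (n + k)`, transfer as an input).  Statements and proofs are otherwise those of the source,
whose documentation follows.

# Line `develop-the-model-growth-descent` (crux `ShellsToBarlowChart`, stmt-AtomisticToContinuum-9227): STAR and LINK from the label table of a site

Helper lemmas for `stub_transportSystem` (the geometric half of the line): frames `⟨x, t₁, t₂, U⟩`
read in the integer charts `IsZChart` of a good-shell configuration, their transports and the
coherence of the resulting development `frameAt`.  The only metric inputs are the chart transfer
lemma and `bond_nb_iff`; everything else is label combinatorics in `ℤ³` (pattern facts
`TransportPatterns*`).  All `[folklore]` (HalesDSP2012 §1.3 for the two kissing patterns).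
-/

noncomputable section

namespace Summit.AtomisticToContinuum.Crystallization.Theorems.SquareWellLayerCakeGapTwelveToBarlow

open Literature.Geometry.DiscreteGeometry Literature.MathematicalPhysics.StatisticalMechanics
open Summit.AtomisticToContinuum.Crystallization.Theorems.PalmUnimodularRigidityShellsToBarlowChart hiding
  IsZChart TransportSystem scales_tied sqNormInt_transfer bond_symm nb_mem zlab_spec zlab_nb
  bond_nb_iff pattern_cases transfer_nb_nb transfer_nb_centre transfer_nb_target
  sqNormInt_zlab_centre hcp_of_mirror_pair Istep_spec Jstep_spec IinvStep_spec JinvStep_spec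
  capWithAny_of_mem_cap IinvStep_Istep Istep_IinvStep JinvStep_Jstep Jstep_JinvStep polar_at_apex
  onesided_at_apex Vstep_spec nb_inj Istep_lower Jstep_lower IinvStep_lower JinvStep_lower
  polar_at_lower_apex onesided_at_lower_apex VinvStep_spec attach_I_even attach_I_odd
  attach_lower_I_pos attach_lower_I_neg attach_J_even attach_J_odd Vstep_Istep_pt Vstep_Istep_back
  Vstep_Istep_side Vstep_Jstep_pt Vstep_Istep_comm Vstep_Jstep_comm attach_lower_J_pos
  attach_lower_J_neg VinvStep_Istep_pt VinvStep_Jstep_pt VinvStep_Istep_back VinvStep_Istep_side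
  VinvStep_Istep_comm VinvStep_Jstep_comm Istep_Jstep_comm star_core table_fcc_p table_fcc_m
  table_hcp_p table_hcp_m

variable {S : ℕ → Set (EuclideanSpace ℝ (Fin 3))}
  {B : EuclideanSpace ℝ (Fin 3) → EuclideanSpace ℝ (Fin 3) → Prop}
  {Pc : EuclideanSpace ℝ (Fin 3) → Finset (Fin 3 → ℤ)}
  {nb : EuclideanSpace ℝ (Fin 3) → (Fin 3 → ℤ) → EuclideanSpace ℝ (Fin 3)}

variable
  (hch : (∀ n : ℕ, ∀ z ∈ S n, (Pc z = fcc3Int ∨ Pc z = hcpInt) ∧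
      Set.BijOn (nb z) (↑(Pc z) : Set (Fin 3 → ℤ)) {y | B z y} ∧
      ∀ t ∈ Pc z, ∀ t' ∈ Pc z, (B (nb z t) (nb z t') ↔ sqNormInt (t - t') = 18)) ∧
    (∀ n : ℕ, ∀ z ∈ S (n + 1), ∀ y, B z y → y ∈ S n) ∧
    (∀ n m : ℕ, ∀ x ∈ S n, ∀ y ∈ S m, B x y →
      ∀ (z z' : EuclideanSpace ℝ (Fin 3)) (t t' u u' : Fin 3 → ℤ),
        (t = 0 ∧ z = x ∨ t ∈ Pc x ∧ z = nb x t) → (t' = 0 ∧ z' = x ∨ t' ∈ Pc x ∧ z' = nb x t') →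
        (u = 0 ∧ z = y ∨ u ∈ Pc y ∧ z = nb y u) → (u' = 0 ∧ z' = y ∨ u' ∈ Pc y ∧ z' = nb y u') →
        sqNormInt (u - u') = sqNormInt (t - t')) ∧
    (∀ x y, B x y → B y x))

include hch


/-- **STAR and LINK from a label table.**  If the twelve link labels `L y`, `y ∈ linkOffsets`,
are exactly the pattern of `x` and their touching table is `linkAdj`, then `y ↦ nb x (L y)` is a
bijection onto the bonded neighbours of `x`, faithful on links. [folklore] -/
theorem star_core {n : ℕ} {x : (EuclideanSpace ℝ (Fin 3))} (hx : x ∈ S n)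
    {σm σp : ℤ} (L : ℤ × ℤ × ℤ → (Fin 3 → ℤ)) (himg : (linkOffsets σm σp).image L = Pc x)
    (hrows : ∀ y ∈ linkOffsets σm σp, ∀ y' ∈ linkOffsets σm σp,
      (sqNormInt (L y - L y') = 18 ↔ linkAdj σm σp y y'))
    (hcard : (linkOffsets σm σp).card = 12) (hcardP : (Pc x).card = 12)
    (Φ : ℤ × ℤ × ℤ → (EuclideanSpace ℝ (Fin 3))) (hΦ : ∀ y ∈ linkOffsets σm σp, Φ y = nb x (L y)) :
    Set.BijOn Φ (↑(linkOffsets σm σp) : Set (ℤ × ℤ × ℤ)) {z | B x z} ∧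
    ∀ y ∈ linkOffsets σm σp, ∀ y' ∈ linkOffsets σm σp,
      ((B (Φ y) (Φ y')) ↔ linkAdj σm σp y y') := by
  have hLP : ∀ y ∈ linkOffsets σm σp, L y ∈ Pc x := fun y hy => by
    rw [← himg]; exact Finset.mem_image_of_mem L hy
  have hinjL : Set.InjOn L ↑(linkOffsets σm σp) :=
    Finset.card_image_iff.1 (by rw [himg, hcardP, hcard])
  refine ⟨⟨fun y hy => ?_, fun y hy y' hy' heq => ?_, fun z hz => ?_⟩, fun y hy y' hy' => ?_⟩
  · rw [Finset.mem_coe] at hy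
    rw [hΦ y hy]; exact nb_bond hch hx (hLP y hy)
  · rw [Finset.mem_coe] at hy hy'
    rw [hΦ y hy, hΦ y' hy'] at heq
    exact hinjL hy hy' (nb_inj hch hx (hLP y hy) (hLP y' hy') heq)
  · obtain ⟨t, ht, htz⟩ := (hch.1 _ x hx).2.1.surjOn hz
    have ht' : t ∈ (linkOffsets σm σp).image L := by rw [himg]; exact ht
    obtain ⟨y, hy, hLy⟩ := Finset.mem_image.1 ht'
    exact ⟨y, hy, by rw [hΦ y hy, hLy, htz]⟩
  · rw [hΦ y hy, hΦ y' hy', bond_nb_iff hch hx (hLP y hy) (hLP y' hy')]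
    exact hrows y hy y' hy'

/-- **The label table of an FCC site of parity `+1`**: letter below `+1`, lower apex `−c`, the
STAR image and the LINK rows. [folklore] -/
theorem table_fcc_p {n : ℕ} {x : (EuclideanSpace ℝ (Fin 3))} (hx : x ∈ S (n + 1))
    {t₁ t₂ : Fin 3 → ℤ} {U : Finset (Fin 3 → ℤ)} (hU : IsFrame (Pc x) t₁ t₂ U) (hPx : Pc x = fcc3Int)
    (hpar : frameParity t₁ t₂ U = 1) :
    lowerParity t₁ t₂ (lowerCap (Pc x) t₁ t₂ U) = 1 ∧
    apexOf t₁ t₂ (lowerCap (Pc x) t₁ t₂ U) = -apexOf t₁ t₂ U ∧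
    (linkOffsets 1 1).image (fun y : ℤ × ℤ × ℤ =>
      ((if y.1 = 1 then apexOf t₁ t₂ U else if y.1 = -1 then (-apexOf t₁ t₂ U) else 0) - y.2.1 • t₁ - y.2.2 • t₂)) = Pc x ∧
    ∀ y ∈ linkOffsets 1 1, ∀ y' ∈ linkOffsets 1 1,
      (sqNormInt (((if y.1 = 1 then apexOf t₁ t₂ U else if y.1 = -1 then (-apexOf t₁ t₂ U) else 0) - y.2.1 • t₁ - y.2.2 • t₂) -
        ((if y'.1 = 1 then apexOf t₁ t₂ U else if y'.1 = -1 then (-apexOf t₁ t₂ U) else 0) - y'.2.1 • t₁ - y'.2.2 • t₂)) = 18 ↔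
        linkAdj 1 1 y y') := by
  have hP := pattern_cases hch hx
  obtain ⟨h12, hhex, hUP, -, -⟩ := id hU
  obtain ⟨hcU, hcP, hcoff, hc1, hc2, hE⟩ := even_form_of_parity hP hU hpar
  set c := apexOf t₁ t₂ U with hc_def
  have ht₁ : t₁ ∈ Pc x := hhex (mem_hexLabels_iff.2 (Or.inl rfl))
  have ht₂ : t₂ ∈ Pc x := hhex (mem_hexLabels_iff.2 (Or.inr (Or.inl rfl)))
  have ht₁' : t₁ ∈ fcc3Int := by rw [← hPx]; exact ht₁
  have ht₂' : t₂ ∈ fcc3Int := by rw [← hPx]; exact ht₂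
  have hcP' : c ∈ fcc3Int := by rw [← hPx]; exact hcP
  have hc1' : c - t₁ ∈ fcc3Int := by rw [← hPx]; exact hc1
  have hc2' : c - t₂ ∈ fcc3Int := by rw [← hPx]; exact hc2
  have hhex' : hexLabels t₁ t₂ ⊆ fcc3Int := by rw [← hPx]; exact hhex
  have hL : lowerCap (Pc x) t₁ t₂ U = {-c, -c + t₁, -c + t₂} := by
    rw [hE, hPx]; exact lowerCap_evenCap_fcc3Int t₁ ht₁' t₂ ht₂' c hcP' h12 hhex' hcoff hc1' hc2'
  refine ⟨by rw [hL]; exact lowerParity_pos t₁ t₂ (-c), ?_, ?_, ?_⟩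
  · refine apexOf_eq_of_form hP (isFrame_lowerCap hP hU) (by rw [hL]; simp) (Or.inr (by rw [hL]))
  · rw [hPx]; exact star_image_fcc_p t₁ ht₁' t₂ ht₂' c hcP' h12 hhex' hcoff hc1' hc2'
  · intro y hy y' hy'
    rw [linkOffsets_eq_fcc_p] at hy
    simp only [Finset.mem_insert, Finset.mem_singleton] at hy
    rcases hy with rfl | rfl | rfl | rfl | rfl | rfl | rfl | rfl | rfl | rfl | rfl | rfl
    exacts [linkRow_fcc_p_0 y' hy' t₁ ht₁' t₂ ht₂' _ hcP' h12 hhex' hcoff hc1' hc2', linkRow_fcc_p_1 y' hy' t₁ ht₁' t₂ ht₂' _ hcP' h12 hhex' hcoff hc1' hc2', linkRow_fcc_p_2 y' hy' t₁ ht₁' t₂ ht₂' _ hcP' h12 hhex' hcoff hc1' hc2', linkRow_fcc_p_3 y' hy' t₁ ht₁' t₂ ht₂' _ hcP' h12 hhex' hcoff hc1' hc2', linkRow_fcc_p_4 y' hy' t₁ ht₁' t₂ ht₂' _ hcP' h12 hhex' hcoff hc1' hc2', linkRow_fcc_p_5 y' hy' t₁ ht₁' t₂ ht₂' _ hcP'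 h12 hhex' hcoff hc1' hc2', linkRow_fcc_p_6 y' hy' t₁ ht₁' t₂ ht₂' _ hcP' h12 hhex' hcoff hc1' hc2', linkRow_fcc_p_7 y' hy' t₁ ht₁' t₂ ht₂' _ hcP' h12 hhex' hcoff hc1' hc2', linkRow_fcc_p_8 y' hy' t₁ ht₁' t₂ ht₂' _ hcP' h12 hhex' hcoff hc1' hc2', linkRow_fcc_p_9 y' hy' t₁ ht₁' t₂ ht₂' _ hcP' h12 hhex' hcoff hc1' hc2', linkRow_fcc_p_10 y' hy' t₁ ht₁' t₂ ht₂' _ hcP' h12 hhex' hcoff hc1' hc2', linkRow_fcc_p_11 y' hy' t₁ ht₁' t₂ ht₂' _ hcP' h12 hhex' hcoff hc1' hc2']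

/-- **The label table of an FCC site of parity `−1`**: letter below `−1`, lower apex `−c`, the
STAR image and the LINK rows. [folklore] -/
theorem table_fcc_m {n : ℕ} {x : (EuclideanSpace ℝ (Fin 3))} (hx : x ∈ S (n + 1))
    {t₁ t₂ : Fin 3 → ℤ} {U : Finset (Fin 3 → ℤ)} (hU : IsFrame (Pc x) t₁ t₂ U) (hPx : Pc x = fcc3Int)
    (hpar : frameParity t₁ t₂ U = -1) :
    lowerParity t₁ t₂ (lowerCap (Pc x) t₁ t₂ U) = -1 ∧
    apexOf t₁ t₂ (lowerCap (Pc x) t₁ t₂ U) = (-apexOf t₁ t₂ U) ∧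
    (linkOffsets (-1) (-1)).image (fun y : ℤ × ℤ × ℤ =>
      ((if y.1 = 1 then apexOf t₁ t₂ U else if y.1 = -1 then (-apexOf t₁ t₂ U) else 0) - y.2.1 • t₁ - y.2.2 • t₂)) = Pc x ∧
    ∀ y ∈ linkOffsets (-1) (-1), ∀ y' ∈ linkOffsets (-1) (-1),
      (sqNormInt (((if y.1 = 1 then apexOf t₁ t₂ U else if y.1 = -1 then (-apexOf t₁ t₂ U) else 0) - y.2.1 • t₁ - y.2.2 • t₂) -
        ((if y'.1 = 1 then apexOf t₁ t₂ U else if y'.1 = -1 then (-apexOf t₁ t₂ U) else 0) - y'.2.1 • t₁ - y'.2.2 • t₂)) = 18 ↔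
        linkAdj (-1) (-1) y y') := by
  have hP := pattern_cases hch hx
  obtain ⟨h12, hhex, hUP, -, -⟩ := id hU
  obtain ⟨hcU, hcP, hcoff, hc1, hc2, hE⟩ := odd_form_of_parity hP hU hpar
  set c := apexOf t₁ t₂ U with hc_def
  have ht₁ : t₁ ∈ Pc x := hhex (mem_hexLabels_iff.2 (Or.inl rfl))
  have ht₂ : t₂ ∈ Pc x := hhex (mem_hexLabels_iff.2 (Or.inr (Or.inl rfl)))
  have ht₁' : t₁ ∈ fcc3Int := by rw [← hPx]; exact ht₁
  have ht₂' : t₂ ∈ fcc3Int := by rw [← hPx]; exact ht₂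
  have hcP' : c ∈ fcc3Int := by rw [← hPx]; exact hcP
  have hc1' : c + t₁ ∈ fcc3Int := by rw [← hPx]; exact hc1
  have hc2' : c + t₂ ∈ fcc3Int := by rw [← hPx]; exact hc2
  have hhex' : hexLabels t₁ t₂ ⊆ fcc3Int := by rw [← hPx]; exact hhex
  have hL : lowerCap (Pc x) t₁ t₂ U = {-c, -c - t₁, -c - t₂} := by
    rw [hE, hPx]; exact lowerCap_oddCap_fcc3Int t₁ ht₁' t₂ ht₂' c hcP' h12 hhex' hcoff hc1' hc2'
  refine ⟨by rw [hPx] at hU ⊢; rw [hPx] at hL; exact lowerParity_of_even_form (Or.inl rfl) hU hL, ?_, ?_, ?_⟩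
  · refine apexOf_eq_of_form hP (isFrame_lowerCap hP hU) (by rw [hL]; simp) (Or.inl (by rw [hL]))
  · rw [hPx]; exact star_image_fcc_m t₁ ht₁' t₂ ht₂' c hcP' h12 hhex' hcoff hc1' hc2'
  · intro y hy y' hy'
    rw [linkOffsets_eq_fcc_m] at hy
    simp only [Finset.mem_insert, Finset.mem_singleton] at hy
    rcases hy with rfl | rfl | rfl | rfl | rfl | rfl | rfl | rfl | rfl | rfl | rfl | rfl
    exacts [linkRow_fcc_m_0 y' hy' t₁ ht₁' t₂ ht₂' _ hcP' h12 hhex' hcoff hc1' hc2', linkRow_fcc_m_1 y' hy' t₁ ht₁' t₂ ht₂' _ hcP' h12 hhex' hcoff hc1' hc2', linkRow_fcc_m_2 y' hy' t₁ ht₁' t₂ ht₂' _ hcP' h12 hhex' hcoff hc1' hc2', linkRow_fcc_m_3 y' hy' t₁ ht₁' t₂ ht₂' _ hcP' h12 hhex' hcoff hc1' hc2', linkRow_fcc_m_4 y' hy' t₁ ht₁' t₂ ht₂' _ hcP' h12 hhex' hcoff hc1' hc2', linkRow_fcc_m_5 y' hy' t₁ ht₁' t₂ ht₂' _ hcP'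 h12 hhex' hcoff hc1' hc2', linkRow_fcc_m_6 y' hy' t₁ ht₁' t₂ ht₂' _ hcP' h12 hhex' hcoff hc1' hc2', linkRow_fcc_m_7 y' hy' t₁ ht₁' t₂ ht₂' _ hcP' h12 hhex' hcoff hc1' hc2', linkRow_fcc_m_8 y' hy' t₁ ht₁' t₂ ht₂' _ hcP' h12 hhex' hcoff hc1' hc2', linkRow_fcc_m_9 y' hy' t₁ ht₁' t₂ ht₂' _ hcP' h12 hhex' hcoff hc1' hc2', linkRow_fcc_m_10 y' hy' t₁ ht₁' t₂ ht₂' _ hcP' h12 hhex' hcoff hc1' hc2', linkRow_fcc_m_11 y' hy' t₁ ht₁' t₂ ht₂' _ hcP' h12 hhex' hcoff hc1' hc2']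

/-- **The label table of an HCP site of parity `+1`**: letter below `−1`, lower apex `c − (Σc/6·4)(1,1,1)`, the
STAR image and the LINK rows. [folklore] -/
theorem table_hcp_p {n : ℕ} {x : (EuclideanSpace ℝ (Fin 3))} (hx : x ∈ S (n + 1))
    {t₁ t₂ : Fin 3 → ℤ} {U : Finset (Fin 3 → ℤ)} (hU : IsFrame (Pc x) t₁ t₂ U) (hPx : Pc x = hcpInt)
    (hpar : frameParity t₁ t₂ U = 1) :
    lowerParity t₁ t₂ (lowerCap (Pc x) t₁ t₂ U) = -1 ∧
    apexOf t₁ t₂ (lowerCap (Pc x) t₁ t₂ U) = (apexOf t₁ t₂ U - ((apexOf t₁ t₂ U 0 + apexOf t₁ t₂ U 1 + apexOf t₁ t₂ U 2) / 6 * 4) • (1 : Fin 3 → ℤ)) ∧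
    (linkOffsets (-1) 1).image (fun y : ℤ × ℤ × ℤ =>
      ((if y.1 = 1 then apexOf t₁ t₂ U else if y.1 = -1 then (apexOf t₁ t₂ U - ((apexOf t₁ t₂ U 0 + apexOf t₁ t₂ U 1 + apexOf t₁ t₂ U 2) / 6 * 4) • (1 : Fin 3 → ℤ)) else 0) - y.2.1 • t₁ - y.2.2 • t₂)) = Pc x ∧
    ∀ y ∈ linkOffsets (-1) 1, ∀ y' ∈ linkOffsets (-1) 1,
      (sqNormInt (((if y.1 = 1 then apexOf t₁ t₂ U else if y.1 = -1 then (apexOf t₁ t₂ U - ((apexOf t₁ t₂ U 0 + apexOf t₁ t₂ U 1 + apexOf t₁ t₂ U 2) / 6 * 4) • (1 : Fin 3 → ℤ)) else 0) - y.2.1 • t₁ - y.2.2 • t₂) -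
        ((if y'.1 = 1 then apexOf t₁ t₂ U else if y'.1 = -1 then (apexOf t₁ t₂ U - ((apexOf t₁ t₂ U 0 + apexOf t₁ t₂ U 1 + apexOf t₁ t₂ U 2) / 6 * 4) • (1 : Fin 3 → ℤ)) else 0) - y'.2.1 • t₁ - y'.2.2 • t₂)) = 18 ↔
        linkAdj (-1) 1 y y') := by
  have hP := pattern_cases hch hx
  obtain ⟨h12, hhex, hUP, -, -⟩ := id hU
  obtain ⟨hcU, hcP, hcoff, hc1, hc2, hE⟩ := even_form_of_parity hP hU hpar
  set c := apexOf t₁ t₂ U with hc_def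
  have ht₁ : t₁ ∈ Pc x := hhex (mem_hexLabels_iff.2 (Or.inl rfl))
  have ht₂ : t₂ ∈ Pc x := hhex (mem_hexLabels_iff.2 (Or.inr (Or.inl rfl)))
  have ht₁' : t₁ ∈ hcpInt := by rw [← hPx]; exact ht₁
  have ht₂' : t₂ ∈ hcpInt := by rw [← hPx]; exact ht₂
  have hcP' : c ∈ hcpInt := by rw [← hPx]; exact hcP
  have hc1' : c - t₁ ∈ hcpInt := by rw [← hPx]; exact hc1
  have hc2' : c - t₂ ∈ hcpInt := by rw [← hPx]; exact hc2
  have hhex' : hexLabels t₁ t₂ ⊆ hcpInt := by rw [← hPx]; exact hhex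
  have hL : lowerCap (Pc x) t₁ t₂ U = {(c - ((c 0 + c 1 + c 2) / 6 * 4) • (1 : Fin 3 → ℤ)), (c - ((c 0 + c 1 + c 2) / 6 * 4) • (1 : Fin 3 → ℤ)) - t₁, (c - ((c 0 + c 1 + c 2) / 6 * 4) • (1 : Fin 3 → ℤ)) - t₂} := by
    rw [hE, hPx]; exact lowerCap_formula_hcp_p t₁ ht₁' t₂ ht₂' c hcP' h12 hhex' hcoff hc1' hc2'
  refine ⟨by rw [hPx] at hU ⊢; rw [hPx] at hL; exact lowerParity_of_even_form (Or.inr rfl) hU hL, ?_, ?_, ?_⟩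
  · refine apexOf_eq_of_form hP (isFrame_lowerCap hP hU) (by rw [hL]; simp) (Or.inl (by rw [hL]))
  · rw [hPx]; exact star_image_hcp_p t₁ ht₁' t₂ ht₂' c hcP' h12 hhex' hcoff hc1' hc2'
  · intro y hy y' hy'
    rw [linkOffsets_eq_hcp_p] at hy
    simp only [Finset.mem_insert, Finset.mem_singleton] at hy
    rcases hy with rfl | rfl | rfl | rfl | rfl | rfl | rfl | rfl | rfl | rfl | rfl | rfl
    exacts [linkRow_hcp_p_0 y' hy' t₁ ht₁' t₂ ht₂' _ hcP' h12 hhex' hcoff hc1' hc2', linkRow_hcp_p_1 y' hy' t₁ ht₁' t₂ ht₂' _ hcP' h12 hhex' hcoff hc1' hc2', linkRow_hcp_p_2 y' hy' t₁ ht₁' t₂ ht₂' _ hcP' h12 hhex' hcoff hc1' hc2', linkRow_hcp_p_3 y' hy' t₁ ht₁' t₂ ht₂' _ hcP' h12 hhex' hcoff hc1' hc2', linkRow_hcp_p_4 y' hy' t₁ ht₁' t₂ ht₂' _ hcP' h12 hhex' hcoff hc1' hc2', linkRow_hcp_p_5 y' hy' t₁ ht₁' t₂ ht₂' _ hcP'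 h12 hhex' hcoff hc1' hc2', linkRow_hcp_p_6 y' hy' t₁ ht₁' t₂ ht₂' _ hcP' h12 hhex' hcoff hc1' hc2', linkRow_hcp_p_7 y' hy' t₁ ht₁' t₂ ht₂' _ hcP' h12 hhex' hcoff hc1' hc2', linkRow_hcp_p_8 y' hy' t₁ ht₁' t₂ ht₂' _ hcP' h12 hhex' hcoff hc1' hc2', linkRow_hcp_p_9 y' hy' t₁ ht₁' t₂ ht₂' _ hcP' h12 hhex' hcoff hc1' hc2', linkRow_hcp_p_10 y' hy' t₁ ht₁' t₂ ht₂' _ hcP' h12 hhex' hcoff hc1' hc2', linkRow_hcp_p_11 y' hy' t₁ ht₁' t₂ ht₂' _ hcP' h12 hhex' hcoff hc1' hc2']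

/-- **The label table of an HCP site of parity `−1`**: letter below `+1`, lower apex `c − (Σc/6·4)(1,1,1)`, the
STAR image and the LINK rows. [folklore] -/
theorem table_hcp_m {n : ℕ} {x : (EuclideanSpace ℝ (Fin 3))} (hx : x ∈ S (n + 1))
    {t₁ t₂ : Fin 3 → ℤ} {U : Finset (Fin 3 → ℤ)} (hU : IsFrame (Pc x) t₁ t₂ U) (hPx : Pc x = hcpInt)
    (hpar : frameParity t₁ t₂ U = -1) :
    lowerParity t₁ t₂ (lowerCap (Pc x) t₁ t₂ U) = 1 ∧
    apexOf t₁ t₂ (lowerCap (Pc x) t₁ t₂ U) = (apexOf t₁ t₂ U - ((apexOf t₁ t₂ U 0 + apexOf t₁ t₂ U 1 + apexOf t₁ t₂ U 2) / 6 * 4) • (1 : Fin 3 → ℤ)) ∧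
    (linkOffsets 1 (-1)).image (fun y : ℤ × ℤ × ℤ =>
      ((if y.1 = 1 then apexOf t₁ t₂ U else if y.1 = -1 then (apexOf t₁ t₂ U - ((apexOf t₁ t₂ U 0 + apexOf t₁ t₂ U 1 + apexOf t₁ t₂ U 2) / 6 * 4) • (1 : Fin 3 → ℤ)) else 0) - y.2.1 • t₁ - y.2.2 • t₂)) = Pc x ∧
    ∀ y ∈ linkOffsets 1 (-1), ∀ y' ∈ linkOffsets 1 (-1),
      (sqNormInt (((if y.1 = 1 then apexOf t₁ t₂ U else if y.1 = -1 then (apexOf t₁ t₂ U - ((apexOf t₁ t₂ U 0 + apexOf t₁ t₂ U 1 + apexOf t₁ t₂ U 2) / 6 * 4) • (1 : Fin 3 → ℤ)) else 0) - y.2.1 • t₁ - y.2.2 • t₂) -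
        ((if y'.1 = 1 then apexOf t₁ t₂ U else if y'.1 = -1 then (apexOf t₁ t₂ U - ((apexOf t₁ t₂ U 0 + apexOf t₁ t₂ U 1 + apexOf t₁ t₂ U 2) / 6 * 4) • (1 : Fin 3 → ℤ)) else 0) - y'.2.1 • t₁ - y'.2.2 • t₂)) = 18 ↔
        linkAdj 1 (-1) y y') := by
  have hP := pattern_cases hch hx
  obtain ⟨h12, hhex, hUP, -, -⟩ := id hU
  obtain ⟨hcU, hcP, hcoff, hc1, hc2, hE⟩ := odd_form_of_parity hP hU hpar
  set c := apexOf t₁ t₂ U with hc_def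
  have ht₁ : t₁ ∈ Pc x := hhex (mem_hexLabels_iff.2 (Or.inl rfl))
  have ht₂ : t₂ ∈ Pc x := hhex (mem_hexLabels_iff.2 (Or.inr (Or.inl rfl)))
  have ht₁' : t₁ ∈ hcpInt := by rw [← hPx]; exact ht₁
  have ht₂' : t₂ ∈ hcpInt := by rw [← hPx]; exact ht₂
  have hcP' : c ∈ hcpInt := by rw [← hPx]; exact hcP
  have hc1' : c + t₁ ∈ hcpInt := by rw [← hPx]; exact hc1
  have hc2' : c + t₂ ∈ hcpInt := by rw [← hPx]; exact hc2
  have hhex' : hexLabels t₁ t₂ ⊆ hcpInt := by rw [← hPx]; exact hhex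
  have hL : lowerCap (Pc x) t₁ t₂ U = {(c - ((c 0 + c 1 + c 2) / 6 * 4) • (1 : Fin 3 → ℤ)), (c - ((c 0 + c 1 + c 2) / 6 * 4) • (1 : Fin 3 → ℤ)) + t₁, (c - ((c 0 + c 1 + c 2) / 6 * 4) • (1 : Fin 3 → ℤ)) + t₂} := by
    rw [hE, hPx]; exact lowerCap_formula_hcp_m t₁ ht₁' t₂ ht₂' c hcP' h12 hhex' hcoff hc1' hc2'
  refine ⟨by rw [hL]; exact lowerParity_pos t₁ t₂ ((c - ((c 0 + c 1 + c 2) / 6 * 4) • (1 : Fin 3 → ℤ))), ?_, ?_, ?_⟩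
  · refine apexOf_eq_of_form hP (isFrame_lowerCap hP hU) (by rw [hL]; simp) (Or.inr (by rw [hL]))
  · rw [hPx]; exact star_image_hcp_m t₁ ht₁' t₂ ht₂' c hcP' h12 hhex' hcoff hc1' hc2'
  · intro y hy y' hy'
    rw [linkOffsets_eq_hcp_m] at hy
    simp only [Finset.mem_insert, Finset.mem_singleton] at hy
    rcases hy with rfl | rfl | rfl | rfl | rfl | rfl | rfl | rfl | rfl | rfl | rfl | rfl
    exacts [linkRow_hcp_m_0 y' hy' t₁ ht₁' t₂ ht₂' _ hcP' h12 hhex' hcoff hc1' hc2', linkRow_hcp_m_1 y' hy' t₁ ht₁' t₂ ht₂' _ hcP' h12 hhex' hcoff hc1' hc2', linkRow_hcp_m_2 y' hy' t₁ ht₁' t₂ ht₂' _ hcP' h12 hhex' hcoff hc1' hc2', linkRow_hcp_m_3 y' hy' t₁ ht₁' t₂ ht₂' _ hcP' h12 hhex' hcoff hc1' hc2', linkRow_hcp_m_4 y' hy' t₁ ht₁' t₂ ht₂' _ hcP' h12 hhex' hcoff hc1' hc2', linkRow_hcp_m_5 y' hy' t₁ ht₁' t₂ ht₂' _ hcP'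 h12 hhex' hcoff hc1' hc2', linkRow_hcp_m_6 y' hy' t₁ ht₁' t₂ ht₂' _ hcP' h12 hhex' hcoff hc1' hc2', linkRow_hcp_m_7 y' hy' t₁ ht₁' t₂ ht₂' _ hcP' h12 hhex' hcoff hc1' hc2', linkRow_hcp_m_8 y' hy' t₁ ht₁' t₂ ht₂' _ hcP' h12 hhex' hcoff hc1' hc2', linkRow_hcp_m_9 y' hy' t₁ ht₁' t₂ ht₂' _ hcP' h12 hhex' hcoff hc1' hc2', linkRow_hcp_m_10 y' hy' t₁ ht₁' t₂ ht₂' _ hcP' h12 hhex' hcoff hc1' hc2', linkRow_hcp_m_11 y' hy' t₁ ht₁' t₂ ht₂' _ hcP' h12 hhex' hcoff hc1' hc2']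

/-! ## Registered anchor (closed form) -/

omit hch in
/-- **Closed form of `table_fcc_p`** (the registered anchor of this file): the section data
`S, B, Pc, nb` and the standing hypothesis written out (two hypotheses regrouped). [folklore] -/
theorem table_fcc_p_graded :
    ∀ {S : ℕ → Set (EuclideanSpace ℝ (Fin 3))} {B : EuclideanSpace ℝ (Fin 3) → EuclideanSpace ℝ
    (Fin 3) → Prop} {Pc : EuclideanSpace ℝ (Fin 3) → Finset (Fin 3 → ℤ)} {nb : EuclideanSpace ℝ
    (Fin 3) → (Fin 3 → ℤ) → EuclideanSpace ℝ (Fin 3)}, ((∀ n : ℕ, ∀ z ∈ S n, (Pc z =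
    Summit.AtomisticToContinuum.Crystallization.Theorems.PalmUnimodularRigidityShellsToBarlowChart.fcc3Int
    ∨ Pc z = Literature.Geometry.DiscreteGeometry.hcpInt) ∧ Set.BijOn (nb z) (↑(Pc z) : Set (Fin
    3 → ℤ)) {y | B z y} ∧ ∀ t ∈ Pc z, ∀ t' ∈ Pc z, (B (nb z t) (nb z t') ↔
    Literature.Geometry.DiscreteGeometry.sqNormInt (t - t') = 18)) ∧ (∀ n : ℕ, ∀ z ∈ S (n + 1),
    ∀ y, B z y → y ∈ S n) ∧ (∀ n m : ℕ, ∀ x ∈ S n, ∀ y ∈ S m, B x y → ∀ (z z' : EuclideanSpace ℝ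
    (Fin 3)) (t t' u u' : Fin 3 → ℤ), (t = 0 ∧ z = x ∨ t ∈ Pc x ∧ z = nb x t) → (t' = 0 ∧ z' = x
    ∨ t' ∈ Pc x ∧ z' = nb x t') → (u = 0 ∧ z = y ∨ u ∈ Pc y ∧ z = nb y u) → (u' = 0 ∧ z' = y ∨
    u' ∈ Pc y ∧ z' = nb y u') → Literature.Geometry.DiscreteGeometry.sqNormInt (u - u') =
    Literature.Geometry.DiscreteGeometry.sqNormInt (t - t')) ∧ (∀ x y, B x y → B y x)) → ∀ {n :
    ℕ} {x : (EuclideanSpace ℝ (Fin 3))} {t₁ t₂ : Fin 3 → ℤ} {U : Finset (Fin 3 → ℤ)},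
    Summit.AtomisticToContinuum.Crystallization.Theorems.PalmUnimodularRigidityShellsToBarlowChart.IsFrame
    (Pc x) t₁ t₂ U → x ∈ S (n + 1) → Pc x =
    Summit.AtomisticToContinuum.Crystallization.Theorems.PalmUnimodularRigidityShellsToBarlowChart.fcc3Int
    →
    Summit.AtomisticToContinuum.Crystallization.Theorems.PalmUnimodularRigidityShellsToBarlowChart.frameParity
    t₁ t₂ U = 1 →
    Summit.AtomisticToContinuum.Crystallization.Theorems.PalmUnimodularRigidityShellsToBarlowChart.lowerParity
    t₁ t₂
    (Summit.AtomisticToContinuum.Crystallization.Theorems.PalmUnimodularRigidityShellsToBarlowChart.lowerCap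
    (Pc x) t₁ t₂ U) = 1 ∧
    Summit.AtomisticToContinuum.Crystallization.Theorems.PalmUnimodularRigidityShellsToBarlowChart.apexOf
    t₁ t₂
    (Summit.AtomisticToContinuum.Crystallization.Theorems.PalmUnimodularRigidityShellsToBarlowChart.lowerCap
    (Pc x) t₁ t₂ U) =
    -Summit.AtomisticToContinuum.Crystallization.Theorems.PalmUnimodularRigidityShellsToBarlowChart.apexOf
    t₁ t₂ U ∧ (Literature.MathematicalPhysics.StatisticalMechanics.linkOffsets 1 1).image (fun y
    : ℤ × ℤ × ℤ => ((if y.1 = 1 then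
    Summit.AtomisticToContinuum.Crystallization.Theorems.PalmUnimodularRigidityShellsToBarlowChart.apexOf
    t₁ t₂ U else if y.1 = -1 then
    (-Summit.AtomisticToContinuum.Crystallization.Theorems.PalmUnimodularRigidityShellsToBarlowChart.apexOf
    t₁ t₂ U) else 0) - y.2.1 • t₁ - y.2.2 • t₂)) = Pc x ∧ ∀ y ∈
    Literature.MathematicalPhysics.StatisticalMechanics.linkOffsets 1 1, ∀ y' ∈
    Literature.MathematicalPhysics.StatisticalMechanics.linkOffsets 1 1,
    (Literature.Geometry.DiscreteGeometry.sqNormInt (((if y.1 = 1 then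
    Summit.AtomisticToContinuum.Crystallization.Theorems.PalmUnimodularRigidityShellsToBarlowChart.apexOf
    t₁ t₂ U else if y.1 = -1 then
    (-Summit.AtomisticToContinuum.Crystallization.Theorems.PalmUnimodularRigidityShellsToBarlowChart.apexOf
    t₁ t₂ U) else 0) - y.2.1 • t₁ - y.2.2 • t₂) - ((if y'.1 = 1 then
    Summit.AtomisticToContinuum.Crystallization.Theorems.PalmUnimodularRigidityShellsToBarlowChart.apexOf
    t₁ t₂ U else if y'.1 = -1 then
    (-Summit.AtomisticToContinuum.Crystallization.Theorems.PalmUnimodularRigidityShellsToBarlowChart.apexOf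
    t₁ t₂ U) else 0) - y'.2.1 • t₁ - y'.2.2 • t₂)) = 18 ↔
    Literature.MathematicalPhysics.StatisticalMechanics.linkAdj 1 1 y y') := by
  intro S B Pc nb hch n x t₁ t₂ U hU hx hPx hpar
  exact table_fcc_p hch hx hU hPx hpar

end Summit.AtomisticToContinuum.Crystallization.Theorems.SquareWellLayerCakeGapTwelveToBarlow

end
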